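import Mathlib
import HarnessLib
import Summits.Ventures.LatticeQCDFlow.Exactness.SUNJitteredHMCCertificates
import Summits.Ventures.LatticeQCDFlow.Exactness.SUNMetropolisORSweepFiguresOfMerit
import Summits.Ventures.LatticeQCDFlow.Exactness.CabibboMarinariORSweepFiguresOfMerit
import Summits.Ventures.LatticeQCDFlow.Exactness.SUNLeapfrogHMCORSweepFiguresOfMerit
import Summits.Ventures.LatticeQCDFlow.Exactness.NCMCGeneralSpaceDoeblinPowerEveryStart
import Summits.Ventures.LatticeQCDFlow.Scoring.DoeblinPowerBatchMeansTauInt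
import Summits.Ventures.LatticeQCDFlow.Scoring.ChainGlivenkoCantelli

/-!
# Strong laws for the engine's chains as run, from every start (GEN-23, row 9 eng-latcore, 23-21)

NEW WORK of the cell, not a published result; no definition is introduced; nothing is cited as a fact.
HONEST FRAMING: exact (Metropolis-corrected) sampling algorithms for lattice gauge theory; figures of merit are
autocorrelation/cost numbers at stated couplings and volumes; no continuum-physics claim.

The most basic guarantee behind every number the cell prints from ONE run started cold or hot: the time average of
an observable converges to its Wilson expectation ALMOST SURELY, whatever the initial configuration.  Row 31's
`NCMCGeneralSpaceDoeblinPowerEveryStart.tendsto_sum_div_anyLaw_of_nHit_minorised` proves it for ANY Markov kernel with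
an invariant probability `π` and a Doeblin power `ε ν ≤ K^m(z, ·)`, for EVERY `π`-integrable `φ` (not only bounded
ones) and EVERY initial law `μ₀`; row 8's `Scoring.chain_sampleVariance_ae_tendsto_of_nHit` adds the sample variance;
row 8's `Scoring/ChainGlivenkoCantelli` adds, for chains minorised in ONE step by `π` itself, the uniform almost-sure
convergence of the empirical distribution function of any real observable (Glivenko–Cantelli) and the strong
consistency of sample quantiles at identifiable levels.

THIS FILE applies them to the Doeblin CERTIFICATES of GEN-23 (the engine's update paths AS RUN on `SU(N)`, any `β`,
`L ≥ 2` where a sweep is involved):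

* §1 jittered `'hmc'` with one short atom: **`wilsonJitterHMC_timeAverage_ae_tendsto`** (L: every integrable `φ`),
  **`wilsonJitterHMC_sampleVariance_ae_tendsto`** (V);
* §2 jittered `'hmc'` + ANY exact step: **`wilsonJitterHMC_exactStep_timeAverage_ae_tendsto`** (L);
* §3 DEFAULT fixed-step `'hmc'` + ANY exact step: **`wilson_sunLeapfrogHMCN_exactStep_timeAverage_ae_tendsto`** (L);
* §4 `'metro' + n_or × 'or'`: **`wilson_sunMetropolis_orSweep_timeAverage_ae_tendsto`** (L),
  **`wilson_sunMetropolis_orSweep_sampleVariance_ae_tendsto`** (V);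
* §5 CM `'hb' + n_or × 'or'` (ONE-STEP certificate by `π`): **`wilson_cmSweep_orSweep_timeAverage_ae_tendsto`** (L),
  **`wilson_cmSweep_orSweep_glivenkoCantelli_ae`** (the histogram of any real observable converges uniformly, a.s.,
  every start), **`wilson_cmSweep_orSweep_sampleQuantile_ae_tendsto`** (sample quantiles / running median, a.s.).

NOT CLAIMED: rates (those are the CLT / Hoeffding files); non-integrable observables; the capped heat-bath loops.
-/

noncomputable section

namespace Summit.Ventures.LatticeQCDFlow.Exactness

open MeasureTheory ProbabilityTheory ProbabilityTheory.Kernel Set Function Filter Topology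
open Literature.MathematicalPhysics.QuantumFieldTheory
open Literature.MathematicalPhysics.QuantumLattice (fundamentalRep continuous_fundamentalRep connectedSpace_specialUnitaryGroup)
open scoped ENNReal Matrix Matrix.Norms.Operator NNReal

/-! ## §1 The jittered `'hmc'` path with one short atom -/

section Jittered

variable {N d L : ℕ} [NeZero N] [NeZero L] (β : ℝ)
variable {Lab : Type*} [Countable Lab] [MeasurableSpace Lab] [MeasurableSingletonClass Lab]

/-- **(L) THE ERGODIC THEOREM FROM EVERY START FOR THE JITTERED ENGINE HMC**: there is `τ₀ > 0` (depending on
`N, d, L, β` only) such that whenever one atom `l₀` of the jitter law has `1 ≤ nstep l₀`, `η {l₀} ≠ 0`,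
`0 < τ l₀ ≤ τ₀`: for EVERY `π`-integrable measurable `φ` and EVERY initial law `μ₀`,
`(1/n) Σ_{i<n} φ(U_i) → ∫ φ dπ` `P_{μ₀}`-almost surely (`π = wilsonMeasure (β/N)`). -/
theorem wilsonJitterHMC_timeAverage_ae_tendsto :
    ∃ τ₀ : ℝ, 0 < τ₀ ∧ ∀ (nstep : Lab → ℕ) (τ : Lab → ℝ) (η : Measure Lab) [IsProbabilityMeasure η] (l₀ : Lab),
      1 ≤ nstep l₀ → η {l₀} ≠ 0 → 0 < τ l₀ → τ l₀ ≤ τ₀ →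
      ∀ (φ : GaugeConfig d L (Matrix.specialUnitaryGroup (Fin N) ℂ) → ℝ), Measurable φ →
          Integrable φ (wilsonMeasure (d := d) (L := L) (fundamentalRep (Fin N)) (β / N)) →
      ∀ (μ₀ : Measure (GaugeConfig d L (Matrix.specialUnitaryGroup (Fin N) ℂ))) [IsProbabilityMeasure μ₀],
        ∀ᵐ x ∂(Kernel.trajMeasure (X := fun _ : ℕ => GaugeConfig d L (Matrix.specialUnitaryGroup (Fin N) ℂ)) μ₀
              (fun n : ℕ => (wilsonJitterHMC N d L β nstep τ η).comap
                (fun h : (i : ↥(Finset.Iic n)) → GaugeConfig d L (Matrix.specialUnitaryGroup (Fin N) ℂ) => h ⟨n, Finset.mem_Iic.2 le_rfl⟩)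
                (measurable_pi_apply _))),
          Tendsto (fun n : ℕ => (∑ i ∈ Finset.range n, φ (x i)) / n) atTop
            (𝓝 (∫ a, φ a ∂(wilsonMeasure (d := d) (L := L) (fundamentalRep (Fin N)) (β / N)))) := by
  obtain ⟨τ₀, hτ₀, h⟩ := wilsonJitterHMC_certificate (N := N) (d := d) (L := L) (Lab := Lab) β
  refine ⟨τ₀, hτ₀, fun nstep τ η _ l₀ hn hl₀ hτl hτl₀ φ hφm hφ μ₀ _ => ?_⟩
  obtain ⟨m, ε', hm, hε0, hε1, hmin⟩ := h nstep τ η l₀ hn hl₀ hτl hτl₀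
  exact GeneralNCMC.tendsto_sum_div_anyLaw_of_nHit_minorised
    (wilsonJitterHMC_invariant (N := N) (d := d) (L := L) β nstep τ η) hε0.ne' hmin hφm hφ μ₀

/-- **(V) THE SAMPLE VARIANCE OF THE JITTERED ENGINE HMC IS STRONGLY CONSISTENT, EVERY START**: same `τ₀`; for
`|f| ≤ C` measurable and every `μ₀`, `(1/n) Σ f(U_t)² − ((1/n) Σ f(U_t))² → Var_π f` almost surely. -/
theorem wilsonJitterHMC_sampleVariance_ae_tendsto :
    ∃ τ₀ : ℝ, 0 < τ₀ ∧ ∀ (nstep : Lab → ℕ) (τ : Lab → ℝ) (η : Measure Lab) [IsProbabilityMeasure η] (l₀ : Lab),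
      1 ≤ nstep l₀ → η {l₀} ≠ 0 → 0 < τ l₀ → τ l₀ ≤ τ₀ →
      ∀ (f : GaugeConfig d L (Matrix.specialUnitaryGroup (Fin N) ℂ) → ℝ), Measurable f → ∀ C : ℝ, (∀ U, |f U| ≤ C) →
      ∀ (μ₀ : Measure (GaugeConfig d L (Matrix.specialUnitaryGroup (Fin N) ℂ))) [IsProbabilityMeasure μ₀],
        ∀ᵐ x ∂(Kernel.trajMeasure (X := fun _ : ℕ => GaugeConfig d L (Matrix.specialUnitaryGroup (Fin N) ℂ)) μ₀
              (fun n : ℕ => (wilsonJitterHMC N d L β nstep τ η).comap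
                (fun h : (i : ↥(Finset.Iic n)) → GaugeConfig d L (Matrix.specialUnitaryGroup (Fin N) ℂ) => h ⟨n, Finset.mem_Iic.2 le_rfl⟩)
                (measurable_pi_apply _))),
          Tendsto (fun n : ℕ => (∑ t ∈ Finset.range n, f (x t) ^ 2) / n - ((∑ t ∈ Finset.range n, f (x t)) / n) ^ 2) atTop
            (𝓝 (∫ z, (f z - ∫ z', f z' ∂(wilsonMeasure (d := d) (L := L) (fundamentalRep (Fin N)) (β / N))) ^ 2
              ∂(wilsonMeasure (d := d) (L := L) (fundamentalRep (Fin N)) (β / N)))) := by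
  obtain ⟨τ₀, hτ₀, h⟩ := wilsonJitterHMC_certificate (N := N) (d := d) (L := L) (Lab := Lab) β
  refine ⟨τ₀, hτ₀, fun nstep τ η _ l₀ hn hl₀ hτl hτl₀ f hf C hC μ₀ _ => ?_⟩
  obtain ⟨m, ε', hm, hε0, hε1, hmin⟩ := h nstep τ η l₀ hn hl₀ hτl hτl₀
  exact Scoring.chain_sampleVariance_ae_tendsto_of_nHit
    (wilsonJitterHMC_invariant (N := N) (d := d) (L := L) β nstep τ η) hmin hε0 hf hC μ₀

/-! ## §2 The jittered `'hmc'` path followed by ANY exact step -/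

/-- **(L) FOR THE COMPOSITE `P ∘ K_jit`** — `P` ANY Markov kernel leaving `wilsonMeasure (β/N)` invariant: the time
average of every `π`-integrable `φ` converges to `∫ φ dπ` almost surely, from every start. -/
theorem wilsonJitterHMC_exactStep_timeAverage_ae_tendsto :
    ∃ τ₀ : ℝ, 0 < τ₀ ∧ ∀ (nstep : Lab → ℕ) (τ : Lab → ℝ) (η : Measure Lab) [IsProbabilityMeasure η] (l₀ : Lab),
      1 ≤ nstep l₀ → η {l₀} ≠ 0 → 0 < τ l₀ → τ l₀ ≤ τ₀ →
      ∀ (P : Kernel (GaugeConfig d L (Matrix.specialUnitaryGroup (Fin N) ℂ)) (GaugeConfig d L (Matrix.specialUnitaryGroup (Fin N) ℂ)))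
        [IsMarkovKernel P], Invariant P (wilsonMeasure (d := d) (L := L) (fundamentalRep (Fin N)) (β / N)) →
      ∀ (φ : GaugeConfig d L (Matrix.specialUnitaryGroup (Fin N) ℂ) → ℝ), Measurable φ →
          Integrable φ (wilsonMeasure (d := d) (L := L) (fundamentalRep (Fin N)) (β / N)) →
      ∀ (μ₀ : Measure (GaugeConfig d L (Matrix.specialUnitaryGroup (Fin N) ℂ))) [IsProbabilityMeasure μ₀],
        ∀ᵐ x ∂(Kernel.trajMeasure (X := fun _ : ℕ => GaugeConfig d L (Matrix.specialUnitaryGroup (Fin N) ℂ)) μ₀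
              (fun n : ℕ => (P ∘ₖ wilsonJitterHMC N d L β nstep τ η).comap
                (fun h : (i : ↥(Finset.Iic n)) → GaugeConfig d L (Matrix.specialUnitaryGroup (Fin N) ℂ) => h ⟨n, Finset.mem_Iic.2 le_rfl⟩)
                (measurable_pi_apply _))),
          Tendsto (fun n : ℕ => (∑ i ∈ Finset.range n, φ (x i)) / n) atTop
            (𝓝 (∫ a, φ a ∂(wilsonMeasure (d := d) (L := L) (fundamentalRep (Fin N)) (β / N)))) := by
  obtain ⟨τ₀, hτ₀, h⟩ := wilsonJitterHMC_exactStep_certificate (N := N) (d := d) (L := L) (Lab := Lab) β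
  refine ⟨τ₀, hτ₀, fun nstep τ η _ l₀ hn hl₀ hτl hτl₀ P _ hP φ hφm hφ μ₀ _ => ?_⟩
  obtain ⟨hinv, m, ε', hm, hε0, hε1, hmin⟩ := h nstep τ η l₀ hn hl₀ hτl hτl₀ P hP
  haveI := isMarkovKernel_wilsonJitterHMC (N := N) (d := d) (L := L) β nstep τ η
  exact GeneralNCMC.tendsto_sum_div_anyLaw_of_nHit_minorised hinv hε0.ne' hmin hφm hφ μ₀

end Jittered

/-! ## §3 The DEFAULT fixed-step `'hmc'` followed by ANY exact step -/

section FixedStep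

variable (N : ℕ) [NeZero N] {d L : ℕ} [NeZero L] (β : ℝ)

/-- **(L) FOR `P ∘ K_hmc` (FIXED STEP, `nstep · ε ≤ τ₀`)** — `P` ANY exact step: the ergodic theorem from every
start, every `π`-integrable `φ`. -/
theorem wilson_sunLeapfrogHMCN_exactStep_timeAverage_ae_tendsto :
    ∃ τ₀ : ℝ, 0 < τ₀ ∧ ∀ (nstep : ℕ) (ε : ℝ), 1 ≤ nstep → 0 < ε → nstep * ε ≤ τ₀ →
      ∀ (P : Kernel (GaugeConfig d L (Matrix.specialUnitaryGroup (Fin N) ℂ)) (GaugeConfig d L (Matrix.specialUnitaryGroup (Fin N) ℂ)))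
        [IsMarkovKernel P], Invariant P (wilsonMeasure (d := d) (L := L) (fundamentalRep (Fin N)) (β / N)) →
      ∀ [IsMarkovKernel (sunLeapfrogHMCN (sunCoordι N) (sunCoordι_skew N) ε (Measure.addHaar : Measure (SUNCoords N))
                  (sunKinetic N) (measurable_halfKick_sun N (measurable_sunWilsonForceLaw_coeConfig N (d := d) (L := L) β) ε)
                  (fun U => β / N * wilsonAction (fundamentalRep (Fin N)) U) nstep)],
      ∀ (φ : GaugeConfig d L (Matrix.specialUnitaryGroup (Fin N) ℂ) → ℝ), Measurable φ →
          Integrable φ (wilsonMeasure (d := d) (L := L) (fundamentalRep (Fin N)) (β / N)) →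
      ∀ (μ₀ : Measure (GaugeConfig d L (Matrix.specialUnitaryGroup (Fin N) ℂ))) [IsProbabilityMeasure μ₀],
        ∀ᵐ x ∂(Kernel.trajMeasure (X := fun _ : ℕ => GaugeConfig d L (Matrix.specialUnitaryGroup (Fin N) ℂ)) μ₀
              (fun n : ℕ => (P ∘ₖ (sunLeapfrogHMCN (sunCoordι N) (sunCoordι_skew N) ε (Measure.addHaar : Measure (SUNCoords N))
                  (sunKinetic N) (measurable_halfKick_sun N (measurable_sunWilsonForceLaw_coeConfig N (d := d) (L := L) β) ε)
                  (fun U => β / N * wilsonAction (fundamentalRep (Fin N)) U) nstep)).comap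
                (fun h : (i : ↥(Finset.Iic n)) → GaugeConfig d L (Matrix.specialUnitaryGroup (Fin N) ℂ) => h ⟨n, Finset.mem_Iic.2 le_rfl⟩)
                (measurable_pi_apply _))),
          Tendsto (fun n : ℕ => (∑ i ∈ Finset.range n, φ (x i)) / n) atTop
            (𝓝 (∫ a, φ a ∂(wilsonMeasure (d := d) (L := L) (fundamentalRep (Fin N)) (β / N)))) := by
  obtain ⟨τ₀, hτ₀, h⟩ := wilson_sunLeapfrogHMCN_exactStep_certificate N (d := d) (L := L) β
  refine ⟨τ₀, hτ₀, fun nstep ε hn hε hτ P _ hP _ φ hφm hφ μ₀ _ => ?_⟩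
  obtain ⟨hinv, m, ε', hm, hε0, hε1, hmin⟩ := h nstep ε hn hε hτ P hP
  exact GeneralNCMC.tendsto_sum_div_anyLaw_of_nHit_minorised hinv hε0.ne' hmin hφm hφ μ₀

end FixedStep

/-! ## §4 `'metro' + n_or × 'or'` -/

section MetroOR

variable (N : ℕ) (s : ℝ) [Fact (0 < s)] [NeZero N]
variable {d L : ℕ} {m : Type*} [Fintype m] [DecidableEq m]

/-- **(L) FOR `'metro' + n_or × 'or'`** (`L ≥ 2`, `nhit ≥ 1`, the link list visits every link, any OR schedule): the
ergodic theorem from every start for every `π`-integrable `φ` (`π = wilsonMeasure (suRep N) β`). -/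
theorem wilson_sunMetropolis_orSweep_timeAverage_ae_tendsto [NeZero L] (hL : 2 ≤ L) (β : ℝ) {nhit : ℕ} (hn : 1 ≤ nhit)
    {Ls : List (Edge d L)} (hLs : ∀ e, e ∈ Ls) (sched : List (Edge d L × (Fin N ≃ Fin 2 ⊕ m)))
    [IsMarkovKernel (metropolisSweep (sunMetropolisKick N s)
                (fun U : GaugeConfig d L (Matrix.specialUnitaryGroup (Fin N) ℂ) => Real.exp (-β * wilsonAction (suRep N) U)) nhit Ls)]
    {φ : GaugeConfig d L (Matrix.specialUnitaryGroup (Fin N) ℂ) → ℝ} (hφm : Measurable φ) (hφ : Integrable φ (wilsonMeasure (d := d) (L := L) (suRep N) β))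
    (μ₀ : Measure (GaugeConfig d L (Matrix.specialUnitaryGroup (Fin N) ℂ))) [IsProbabilityMeasure μ₀] :
    ∀ᵐ x ∂(Kernel.trajMeasure (X := fun _ : ℕ => GaugeConfig d L (Matrix.specialUnitaryGroup (Fin N) ℂ)) μ₀
          (fun n : ℕ => (cmORSweep sched ∘ₖ metropolisSweep (sunMetropolisKick N s)
                (fun U : GaugeConfig d L (Matrix.specialUnitaryGroup (Fin N) ℂ) => Real.exp (-β * wilsonAction (suRep N) U)) nhit Ls).comap
            (fun h : (i : ↥(Finset.Iic n)) → GaugeConfig d L (Matrix.specialUnitaryGroup (Fin N) ℂ) => h ⟨n, Finset.mem_Iic.2 le_rfl⟩)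
            (measurable_pi_apply _))),
      Tendsto (fun n : ℕ => (∑ i ∈ Finset.range n, φ (x i)) / n) atTop (𝓝 (∫ a, φ a ∂(wilsonMeasure (d := d) (L := L) (suRep N) β))) := by
  haveI := isProbabilityMeasure_wilsonMeasure_suRep N (d := d) (L := L) β
  obtain ⟨hinv, mm, ε', hmm, hε0, hε1, hmin⟩ :=
    wilson_sunMetropolis_orSweep_certificate N s (d := d) hL β hn hLs sched
  exact GeneralNCMC.tendsto_sum_div_anyLaw_of_nHit_minorised hinv hε0.ne' hmin hφm hφ μ₀

/-- **(V) FOR `'metro' + n_or × 'or'`**: the sample variance of a bounded `f` is strongly consistent, every start. -/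
theorem wilson_sunMetropolis_orSweep_sampleVariance_ae_tendsto [NeZero L] (hL : 2 ≤ L) (β : ℝ) {nhit : ℕ}
    (hn : 1 ≤ nhit) {Ls : List (Edge d L)} (hLs : ∀ e, e ∈ Ls) (sched : List (Edge d L × (Fin N ≃ Fin 2 ⊕ m)))
    [IsMarkovKernel (metropolisSweep (sunMetropolisKick N s)
                (fun U : GaugeConfig d L (Matrix.specialUnitaryGroup (Fin N) ℂ) => Real.exp (-β * wilsonAction (suRep N) U)) nhit Ls)]
    {f : GaugeConfig d L (Matrix.specialUnitaryGroup (Fin N) ℂ) → ℝ} (hf : Measurable f) {C : ℝ} (hC : ∀ U, |f U| ≤ C)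
    (μ₀ : Measure (GaugeConfig d L (Matrix.specialUnitaryGroup (Fin N) ℂ))) [IsProbabilityMeasure μ₀] :
    ∀ᵐ x ∂(Kernel.trajMeasure (X := fun _ : ℕ => GaugeConfig d L (Matrix.specialUnitaryGroup (Fin N) ℂ)) μ₀
          (fun n : ℕ => (cmORSweep sched ∘ₖ metropolisSweep (sunMetropolisKick N s)
                (fun U : GaugeConfig d L (Matrix.specialUnitaryGroup (Fin N) ℂ) => Real.exp (-β * wilsonAction (suRep N) U)) nhit Ls).comap
            (fun h : (i : ↥(Finset.Iic n)) → GaugeConfig d L (Matrix.specialUnitaryGroup (Fin N) ℂ) => h ⟨n, Finset.mem_Iic.2 le_rfl⟩)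
            (measurable_pi_apply _))),
      Tendsto (fun n : ℕ => (∑ t ∈ Finset.range n, f (x t) ^ 2) / n - ((∑ t ∈ Finset.range n, f (x t)) / n) ^ 2) atTop
        (𝓝 (∫ z, (f z - ∫ z', f z' ∂(wilsonMeasure (d := d) (L := L) (suRep N) β)) ^ 2 ∂(wilsonMeasure (d := d) (L := L) (suRep N) β))) := by
  haveI := isProbabilityMeasure_wilsonMeasure_suRep N (d := d) (L := L) β
  obtain ⟨hinv, mm, ε', hmm, hε0, hε1, hmin⟩ :=
    wilson_sunMetropolis_orSweep_certificate N s (d := d) hL β hn hLs sched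
  exact Scoring.chain_sampleVariance_ae_tendsto_of_nHit hinv hmin hε0 hf hC μ₀

end MetroOR

/-! ## §5 CM `'hb' + n_or × 'or'` (one-step certificate by `π` itself) -/

section CMOR

variable (N : ℕ) [NeZero N] {d L : ℕ} {m : Type*} [Fintype m] [DecidableEq m]

/-- **(L) FOR `'hb' + n_or × 'or'`** (`L ≥ 2`, lexicographic subgroup order or its reverse, every link visited, any OR
schedule): the ergodic theorem from every start for every `π`-integrable `φ`. -/
theorem wilson_cmSweep_orSweep_timeAverage_ae_tendsto [NeZero L] (hL : 2 ≤ L) (β : ℝ) (frames : List (Fin N ≃ Fin 2 ⊕ m))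
    (hlex : frames.map pairOf = lexPairs (Finset.univ.sort (· ≤ ·) : List (Fin N)) ∨
      frames.map pairOf = (lexPairs (Finset.univ.sort (· ≤ ·) : List (Fin N))).reverse)
    {links : List (Edge d L)} (hl : ∀ e, e ∈ links) (sched : List (Edge d L × (Fin N ≃ Fin 2 ⊕ m)))
    [IsMarkovKernel (latSweep (gibbsDensity fun U : GaugeConfig d L (Matrix.specialUnitaryGroup (Fin N) ℂ) => β * wilsonAction (suRep N) U) frames links)]
    {φ : GaugeConfig d L (Matrix.specialUnitaryGroup (Fin N) ℂ) → ℝ} (hφm : Measurable φ) (hφ : Integrable φ (wilsonMeasure (d := d) (L := L) (suRep N) β))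
    (μ₀ : Measure (GaugeConfig d L (Matrix.specialUnitaryGroup (Fin N) ℂ))) [IsProbabilityMeasure μ₀] :
    ∀ᵐ x ∂(Kernel.trajMeasure (X := fun _ : ℕ => GaugeConfig d L (Matrix.specialUnitaryGroup (Fin N) ℂ)) μ₀
          (fun n : ℕ => (cmORSweep sched ∘ₖ
                latSweep (gibbsDensity fun U : GaugeConfig d L (Matrix.specialUnitaryGroup (Fin N) ℂ) => β * wilsonAction (suRep N) U) frames links).comap
            (fun h : (i : ↥(Finset.Iic n)) → GaugeConfig d L (Matrix.specialUnitaryGroup (Fin N) ℂ) => h ⟨n, Finset.mem_Iic.2 le_rfl⟩)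
            (measurable_pi_apply _))),
      Tendsto (fun n : ℕ => (∑ i ∈ Finset.range n, φ (x i)) / n) atTop (𝓝 (∫ a, φ a ∂(wilsonMeasure (d := d) (L := L) (suRep N) β))) := by
  haveI : IsProbabilityMeasure (wilsonMeasure (d := d) (L := L) (suRep N) β) := isProbabilityMeasure_wilsonMeasure _ continuous_suRep β
  obtain ⟨hinv, ε', hε0, hε1, hmin⟩ := wilson_cmSweep_orSweep_certificate N (d := d) hL β frames hlex hl sched
  exact GeneralNCMC.tendsto_sum_div_anyLaw_of_nHit_minorised hinv hε0.ne' hmin hφm hφ μ₀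

/-- **GLIVENKO–CANTELLI FOR `'hb' + n_or × 'or'`, FROM EVERY START**: for every real measurable observable `O`
(the plaquette, a Polyakov loop, the topological charge — atoms allowed) and every initial law, almost surely the
empirical distribution functions `t ↦ #{i<n : O(U_i) ≤ t}/n` converge to `F_π = cdf (π ∘ O⁻¹)` UNIFORMLY on `ℝ`
(the one-step certificate `ε′ π ≤ K(U, ·)` of `CabibboMarinariORSweepFiguresOfMerit` read through `nHit K 1 = K`). -/
theorem wilson_cmSweep_orSweep_glivenkoCantelli_ae [NeZero L] (hL : 2 ≤ L) (β : ℝ) (frames : List (Fin N ≃ Fin 2 ⊕ m))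
    (hlex : frames.map pairOf = lexPairs (Finset.univ.sort (· ≤ ·) : List (Fin N)) ∨
      frames.map pairOf = (lexPairs (Finset.univ.sort (· ≤ ·) : List (Fin N))).reverse)
    {links : List (Edge d L)} (hl : ∀ e, e ∈ links) (sched : List (Edge d L × (Fin N ≃ Fin 2 ⊕ m)))
    [IsMarkovKernel (latSweep (gibbsDensity fun U : GaugeConfig d L (Matrix.specialUnitaryGroup (Fin N) ℂ) => β * wilsonAction (suRep N) U) frames links)]
    {O : GaugeConfig d L (Matrix.specialUnitaryGroup (Fin N) ℂ) → ℝ} (hO : Measurable O)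
    (μ₀ : Measure (GaugeConfig d L (Matrix.specialUnitaryGroup (Fin N) ℂ))) [IsProbabilityMeasure μ₀] :
    ∀ᵐ x ∂(Kernel.trajMeasure (X := fun _ : ℕ => GaugeConfig d L (Matrix.specialUnitaryGroup (Fin N) ℂ)) μ₀
          (fun n : ℕ => (cmORSweep sched ∘ₖ
                latSweep (gibbsDensity fun U : GaugeConfig d L (Matrix.specialUnitaryGroup (Fin N) ℂ) => β * wilsonAction (suRep N) U) frames links).comap
            (fun h : (i : ↥(Finset.Iic n)) → GaugeConfig d L (Matrix.specialUnitaryGroup (Fin N) ℂ) => h ⟨n, Finset.mem_Iic.2 le_rfl⟩)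
            (measurable_pi_apply _))),
      TendstoUniformly (fun (n : ℕ) (t : ℝ) =>
          (∑ i ∈ Finset.range n, (Set.Iic t).indicator (1 : ℝ → ℝ) (O (x i))) / n)
        (cdf ((wilsonMeasure (d := d) (L := L) (suRep N) β).map O)) atTop := by
  haveI : IsProbabilityMeasure (wilsonMeasure (d := d) (L := L) (suRep N) β) := isProbabilityMeasure_wilsonMeasure _ continuous_suRep β
  obtain ⟨hinv, ε', hε0, hε1, hmin⟩ := wilson_cmSweep_orSweep_certificate N (d := d) hL β frames hlex hl sched
  have hmin1 : ∀ x {B : Set (GaugeConfig d L (Matrix.specialUnitaryGroup (Fin N) ℂ))}, MeasurableSet B →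
      ε' * (wilsonMeasure (d := d) (L := L) (suRep N) β) B ≤ (cmORSweep sched ∘ₖ
                latSweep (gibbsDensity fun U : GaugeConfig d L (Matrix.specialUnitaryGroup (Fin N) ℂ) => β * wilsonAction (suRep N) U) frames links) x B := by
    intro x B hB
    have h := GeneralNCMC.minorised_setwise hmin x hB
    rwa [GeneralNCMC.nHit_one] at h
  exact Scoring.GlivenkoCantelli.chain_glivenkoCantelli_ae (μ₀ := μ₀) hinv hmin1 hε0 hO

/-- **SAMPLE QUANTILES OF `'hb' + n_or × 'or'` OUTPUT ARE STRONGLY CONSISTENT, FROM EVERY START**: for a real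
measurable `O`, a level `u ∈ (0, 1)` at which `F_π` is identifiable (`F_π(q_π(u) + δ) > u` for every `δ > 0`) and
every initial law, the empirical `u`-quantile of the first `n` states (the running median for `u = ½`) tends to
`q_π(u) = inf{x : u ≤ F_π(x)}` almost surely. -/
theorem wilson_cmSweep_orSweep_sampleQuantile_ae_tendsto [NeZero L] (hL : 2 ≤ L) (β : ℝ)
    (frames : List (Fin N ≃ Fin 2 ⊕ m))
    (hlex : frames.map pairOf = lexPairs (Finset.univ.sort (· ≤ ·) : List (Fin N)) ∨
      frames.map pairOf = (lexPairs (Finset.univ.sort (· ≤ ·) : List (Fin N))).reverse)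
    {links : List (Edge d L)} (hl : ∀ e, e ∈ links) (sched : List (Edge d L × (Fin N ≃ Fin 2 ⊕ m)))
    [IsMarkovKernel (latSweep (gibbsDensity fun U : GaugeConfig d L (Matrix.specialUnitaryGroup (Fin N) ℂ) => β * wilsonAction (suRep N) U) frames links)]
    {O : GaugeConfig d L (Matrix.specialUnitaryGroup (Fin N) ℂ) → ℝ} (hO : Measurable O) {u : ℝ} (hu0 : 0 < u) (hu1 : u < 1)
    (hid : ∀ δ, 0 < δ → u < cdf ((wilsonMeasure (d := d) (L := L) (suRep N) β).map O) (sInf {x | u ≤ cdf ((wilsonMeasure (d := d) (L := L) (suRep N) β).map O) x} + δ))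
    (μ₀ : Measure (GaugeConfig d L (Matrix.specialUnitaryGroup (Fin N) ℂ))) [IsProbabilityMeasure μ₀] :
    ∀ᵐ x ∂(Kernel.trajMeasure (X := fun _ : ℕ => GaugeConfig d L (Matrix.specialUnitaryGroup (Fin N) ℂ)) μ₀
          (fun n : ℕ => (cmORSweep sched ∘ₖ
                latSweep (gibbsDensity fun U : GaugeConfig d L (Matrix.specialUnitaryGroup (Fin N) ℂ) => β * wilsonAction (suRep N) U) frames links).comap
            (fun h : (i : ↥(Finset.Iic n)) → GaugeConfig d L (Matrix.specialUnitaryGroup (Fin N) ℂ) => h ⟨n, Finset.mem_Iic.2 le_rfl⟩)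
            (measurable_pi_apply _))),
      Tendsto (fun n : ℕ =>
          sInf {y | u ≤ (∑ i ∈ Finset.range n, (Set.Iic y).indicator (1 : ℝ → ℝ) (O (x i))) / n}) atTop
        (𝓝 (sInf {y | u ≤ cdf ((wilsonMeasure (d := d) (L := L) (suRep N) β).map O) y})) := by
  haveI : IsProbabilityMeasure (wilsonMeasure (d := d) (L := L) (suRep N) β) := isProbabilityMeasure_wilsonMeasure _ continuous_suRep β
  obtain ⟨hinv, ε', hε0, hε1, hmin⟩ := wilson_cmSweep_orSweep_certificate N (d := d) hL β frames hlex hl sched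
  have hmin1 : ∀ x {B : Set (GaugeConfig d L (Matrix.specialUnitaryGroup (Fin N) ℂ))}, MeasurableSet B →
      ε' * (wilsonMeasure (d := d) (L := L) (suRep N) β) B ≤ (cmORSweep sched ∘ₖ
                latSweep (gibbsDensity fun U : GaugeConfig d L (Matrix.specialUnitaryGroup (Fin N) ℂ) => β * wilsonAction (suRep N) U) frames links) x B := by
    intro x B hB
    have h := GeneralNCMC.minorised_setwise hmin x hB
    rwa [GeneralNCMC.nHit_one] at h
  exact Scoring.GlivenkoCantelli.chain_sampleQuantile_tendsto_ae (μ₀ := μ₀) hinv hmin1 hε0 hO hu0 hu1 hid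

end CMOR

end Summit.Ventures.LatticeQCDFlow.Exactness

end
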